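import Literature.Analysis.FluidPDE.StatisticalSolutionDirac
import Literature.Analysis.FluidPDE.StatisticalSolutionEnergyEq
import Literature.Analysis.FunctionSpaces.TorusSobolevL4
import HarnessLib

/-!
# The energy equation of steady weak solutions on `T^d`, `d ≤ 4` (proofs)

This file **discharges** the named fact
`Torus.Temam1979_steadyWeakSolution_energy_eq` (`Literature.Analysis.FluidPDE.SteadyNavierStokes`;
Temam 1979, Ch. II §1, (1.21)–(1.22) in the proof of Thm. 1.2): for `d ≤ 4`, `f ∈ L²(T^d)` and
a steady weak solution `u ∈ V` of the space-periodic Navier–Stokes equations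
(`Torus.IsSteadyWeakSolution ν f u`: `(f, w) + ν (u, Δw) + ∫ (u ⊗ u) : ∇w = 0` for all `w ∈ 𝒱`),
`ν ‖∇u‖²_{L²} = (f, u)`; and, through the reduction
`Torus.IsSteadyWeakSolution.isStationaryStatisticalSolution_dirac` (`StatisticalSolutionDirac`),
the named fact `Torus.isStationaryStatisticalSolution_dirac` (`StatisticalSolution`;
Foias–Manley–Rosa–Temam 2001, Ch. IV §1.2, remark pp. 181–182): the Dirac measure at a steady
weak solution `u ∈ V` is a stationary statistical solution.

## The printed argument and its formalisation

Temam (1979), Ch. II, (1.21)–(1.22): in the weak formulation `ν((u, v)) + b(u, u, v) = (f, v)`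
take `v = u`; since `b(u, u, u) = 0` (Lemma 1.3), `ν ‖u‖² = (f, u)`. The test class there is all
of `V`, by the continuity of `b` on `V × V × V` for `n ≤ 4` (Lemma 1.2, (1.13), from the
Sobolev embedding `H¹ ⊂ L⁴`). The tree's `IsSteadyWeakSolution` tests against the smooth class
`𝒱` only, so the proof here runs the printed one through the Fourier (Galerkin) truncations
`P_m u ∈ 𝒱` of `u ∈ V` (`Torus.fourierTruncate`; smooth, divergence free by
`isDivFree_fourierTruncate`, mean zero by `hasZeroMean_fourierTruncate_of_mem`):

1. `w = P_m u` is admissible, and the tested equation reads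
   `(f, P_m u) − ν ‖∇P_m u‖² + ∫ (u ⊗ u) : ∇P_m u = 0`
   (`IsSteadyWeakSolution.galerkin_identity`, from `nsGeneratorPairing_smul_fourierTruncate`).
2. `(f, P_m u) → (f, u)` and `‖∇P_m u‖² → ‖∇u‖²` (Parseval; `tendsto_integral_inner_fourierTruncate`,
   `tendsto_toReal_eGradNormSq_fourierTruncate` of `StatisticalSolutionEnergyEq`).
3. The inertial term tends to `b(u, u, u) = 0`: by weak incompressibility
   `∫ (u ⊗ u) : ∇P_m u = ∫ ⟪D(P_m u) u, u − P_m u⟫` (`inertialPairing_fourierTruncate_eq`), which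
   is bounded by `‖D P_m u‖_{L²} ‖u‖_{L⁴} ‖u − P_m u‖_{L⁴}` (Hölder twice), and
   `‖u − P_m u‖⁴_{L⁴} ≤ K ‖u − P_m u‖⁴_{H¹} = K (∑_{|k|>m} ⟨k⟩² ‖û(k)‖²)² → 0` by the Sobolev
   embedding `H¹(T^d) ⊂ L⁴(T^d)` for `2 ≤ d ≤ 4` (`Torus.lintegral_enorm_pow_four_le_eSobolevNorm`,
   `TorusSobolevL4`: Ladyzhenskaya for `d = 2`, Gagliardo–Nirenberg–Sobolev for `d = 3, 4`) —
   this is Temam's Lemma 1.2; `tendsto_inertialPairing_fourierTruncate_of_card_le_four`.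
   For `d ≤ 1`, `H = {0}` (`mFourierCoeff_coe_eq_zero_of_card_le_one`) and the term vanishes
   identically.

Main results: `IsSteadyWeakSolution.energy_eq'` (every universe),
`Temam1979_steadyWeakSolution_energy_eq_holds`, `isStationaryStatisticalSolution_dirac_holds`.

## References

* R. Temam, *Navier–Stokes Equations: Theory and Numerical Analysis*, North-Holland (1979),
  Ch. II §1: Lemma 1.2 / (1.13), Lemma 1.3, Thm. 1.2 with (1.21)–(1.22). [Temam1979]
* C. Foias, O. Manley, R. Rosa, R. Temam, *Navier–Stokes Equations and Turbulence*, CUP (2001),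
  Ch. IV §1.1 (1.8), §1.2 Def. 1.3 and remark pp. 181–182. [FMRT2001]
* P. Constantin, C. Foias, *Navier–Stokes Equations*, Univ. Chicago Press (1988), Ch. 7,
  (7.2), (7.8). [ConstantinFoias1988]
-/

noncomputable section

open MeasureTheory Filter Topology UnitAddTorus
open scoped InnerProductSpace RealInnerProductSpace ENNReal NNReal

namespace Literature.Analysis.FluidPDE

namespace Torus

variable {d : Type*} [Fintype d] [DecidableEq d]

/-! ### Truncations of fields in `H` are admissible test fields -/

/-- A truncation of an integrable field with vanishing zero mode has zero mean
(`𝓕(P_m v)(0) = v̂(0) = 0` is `complexify (∫ P_m v)`). [folklore] -/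
theorem hasZeroMean_fourierTruncate_of_mFourierCoeff_zero {v : UnitAddTorus d → EuclideanSpace ℝ d}
    (hv : Integrable v volume)
    (h0 : mFourierCoeff (FunctionSpaces.EuclideanSpace.complexify ∘ v) 0 = 0) (m : ℕ) :
    FunctionSpaces.Torus.HasZeroMean (FunctionSpaces.Torus.fourierTruncate m v) := by
  unfold FunctionSpaces.Torus.HasZeroMean
  have h1 : mFourierCoeff (FunctionSpaces.EuclideanSpace.complexify ∘
      FunctionSpaces.Torus.fourierTruncate m v) 0 = 0 := by
    rw [FunctionSpaces.Torus.mFourierCoeff_fourierTruncate hv, if_pos (FunctionSpaces.Torus.zero_mem_freqBall m), h0]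
  rw [FunctionSpaces.Torus.mFourierCoeff_eq_integral_volume] at h1
  simp only [neg_zero, mFourier_zero, ContinuousMap.one_apply, one_smul, Function.comp_apply] at h1
  rw [FunctionSpaces.EuclideanSpace.complexify.integral_comp_comm
    (FunctionSpaces.Torus.fourierTruncate m v)] at h1
  exact FunctionSpaces.EuclideanSpace.complexify_injective (h1.trans (map_zero _).symm)

/-- Truncations of fields in `H` have zero mean. [folklore] -/
theorem hasZeroMean_fourierTruncate_of_mem
    {v : Lp (EuclideanSpace ℝ d) 2 (volume : Measure (UnitAddTorus d))}
    (hv : v ∈ FunctionSpaces.Torus.energySpace d) (m : ℕ) :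
    FunctionSpaces.Torus.HasZeroMean
      (FunctionSpaces.Torus.fourierTruncate m (v : UnitAddTorus d → EuclideanSpace ℝ d)) :=
  hasZeroMean_fourierTruncate_of_mFourierCoeff_zero ((Lp.memLp v).integrable one_le_two)
    (mFourierCoeff_complexify_coe_zero_of_mem hv) m

/-- **The Galerkin identity of a steady weak solution**: testing the steady weak formulation
with the admissible field `w = P_m u ∈ 𝒱` gives
`(f, P_m u) − ν ‖∇P_m u‖² + ∫ (u ⊗ u) : ∇P_m u = 0` (Temam 1979, Ch. II (1.21) with `v = P_m u`;
FMRT 2001, Ch. IV (1.11)). [cite: Temam1979, Ch. II Thm. 1.2, (1.21)–(1.22)] -/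
theorem IsSteadyWeakSolution.galerkin_identity {ν : ℝ} {f : UnitAddTorus d → EuclideanSpace ℝ d}
    {u : FunctionSpaces.Torus.energySpace d} (hu : IsSteadyWeakSolution ν f u) (m : ℕ) :
    (∫ x, ⟪f x, FunctionSpaces.Torus.fourierTruncate m
        ((u : Lp (EuclideanSpace ℝ d) 2 (volume : Measure (UnitAddTorus d))) :
          UnitAddTorus d → EuclideanSpace ℝ d) x⟫_ℝ) -
      ν * (FunctionSpaces.Torus.eGradNormSq (FunctionSpaces.Torus.fourierTruncate m
        ((u : Lp (EuclideanSpace ℝ d) 2 (volume : Measure (UnitAddTorus d))) :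
          UnitAddTorus d → EuclideanSpace ℝ d))).toReal +
      inertialPairing (u : Lp (EuclideanSpace ℝ d) 2 (volume : Measure (UnitAddTorus d)))
        (FunctionSpaces.Torus.fourierTruncate m
          ((u : Lp (EuclideanSpace ℝ d) 2 (volume : Measure (UnitAddTorus d))) :
            UnitAddTorus d → EuclideanSpace ℝ d)) = 0 := by
  set U : UnitAddTorus d → EuclideanSpace ℝ d :=
    ((u : Lp (EuclideanSpace ℝ d) 2 (volume : Measure (UnitAddTorus d))) :
      UnitAddTorus d → EuclideanSpace ℝ d) with hU
  have h := nsGeneratorPairing_smul_fourierTruncate ν f u 1 m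
  rw [one_mul, show (fun x => (1 : ℝ) • FunctionSpaces.Torus.fourierTruncate m U x) =
      FunctionSpaces.Torus.fourierTruncate m U from funext fun x => one_smul _ _] at h
  rw [← h]
  exact hu _ (FunctionSpaces.Torus.isSmooth_fourierTruncate m U)
    (FunctionSpaces.Torus.isDivFree_fourierTruncate (Lp.memLp _) (isWeaklyDivFree_of_mem_energySpace u.2) m)
    (hasZeroMean_fourierTruncate_of_mem u.2 m)

/-! ### The inertial term vanishes in the limit: `2 ≤ d ≤ 4` through `H¹ ⊂ L⁴` -/

section Inertial

omit [Fintype d] [DecidableEq d] in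
/-- Cauchy–Schwarz for lower integrals: `∫ f g ≤ (∫ f²)^{1/2} (∫ g²)^{1/2}` (Mathlib's Hölder
inequality `ENNReal.lintegral_mul_le_Lp_mul_Lq` with `p = q = 2`). [folklore] -/
private theorem lintegral_mul_le_sqrt {α : Type*} [MeasurableSpace α] (μ : Measure α)
    {f g : α → ℝ≥0∞} (hf : AEMeasurable f μ) (hg : AEMeasurable g μ) :
    ∫⁻ x, f x * g x ∂μ ≤ (∫⁻ x, f x ^ 2 ∂μ) ^ (1 / 2 : ℝ) * (∫⁻ x, g x ^ 2 ∂μ) ^ (1 / 2 : ℝ) := by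
  have h := ENNReal.lintegral_mul_le_Lp_mul_Lq μ Real.HolderConjugate.two_two hf hg
  simpa only [ENNReal.rpow_two, Pi.mul_apply] using h

omit [DecidableEq d] in
/-- The torus derivative of a smooth field is continuous (through the lift:
`Dw ∘ proj = D(w ∘ proj)`). [folklore] -/
theorem continuous_fderiv_of_isSmooth {F : Type*} [NormedAddCommGroup F] [NormedSpace ℝ F]
    {w : UnitAddTorus d → F} (hw : FunctionSpaces.Torus.IsSmooth w) :
    Continuous fun x => FunctionSpaces.Torus.fderiv w x := by
  rw [← FunctionSpaces.Torus.continuous_lift_iff]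
  have h : FunctionSpaces.Torus.lift (fun x => FunctionSpaces.Torus.fderiv w x) =
      _root_.fderiv ℝ (FunctionSpaces.Torus.lift w) := by
    funext y
    rw [FunctionSpaces.Torus.lift_apply, FunctionSpaces.Torus.fderiv_lift]
  rw [h]
  exact hw.continuous_fderiv (by simp)

/-- **The inertial term against a truncation, bounded through `L⁴`**: for `v ∈ H`,
`|∫ (v ⊗ v) : ∇P_m v|² ≤ (d ‖∇v‖²) · ‖v‖²_{L⁴} · ‖P_m v − v‖²_{L⁴}` in `ℝ≥0∞`
(`∫ (v ⊗ v) : ∇P_m v = ∫ ⟪D(P_m v) v, v − P_m v⟫` by weak incompressibility,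
`inertialPairing_fourierTruncate_eq`, then Hölder twice and `‖D P_m v‖²_{L²} ≤ d ‖∇v‖²`). This is
the estimate `|b(u, v, w)| ≤ c ‖u‖_{L⁴} ‖v‖ ‖w‖_{L⁴}` behind Temam 1979, Ch. II Lemma 1.2 / (1.13).
[cite: Temam1979, Ch. II §1.1 Lemma 1.2, (1.13)] -/
theorem enorm_inertialPairing_fourierTruncate_sq_le
    {v : Lp (EuclideanSpace ℝ d) 2 (volume : Measure (UnitAddTorus d))}
    (hv : v ∈ FunctionSpaces.Torus.energySpace d) (m : ℕ) :
    ‖inertialPairing v (FunctionSpaces.Torus.fourierTruncate m (v : UnitAddTorus d → EuclideanSpace ℝ d))‖ₑ ^ 2 ≤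
      (Fintype.card d * FunctionSpaces.Torus.eGradNormSq (v : UnitAddTorus d → EuclideanSpace ℝ d)) *
        ((∫⁻ x, ‖(v : UnitAddTorus d → EuclideanSpace ℝ d) x‖ₑ ^ 4) ^ (1 / 2 : ℝ) *
          (∫⁻ x, ‖FunctionSpaces.Torus.fourierTruncate m (v : UnitAddTorus d → EuclideanSpace ℝ d) x -
            (v : UnitAddTorus d → EuclideanSpace ℝ d) x‖ₑ ^ 4) ^ (1 / 2 : ℝ)) := by
  rw [inertialPairing_fourierTruncate_eq hv m]
  set u : UnitAddTorus d → EuclideanSpace ℝ d := (v : UnitAddTorus d → EuclideanSpace ℝ d) with hu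
  set w := FunctionSpaces.Torus.fourierTruncate m u with hw_def
  have hmem : MemLp u 2 volume := Lp.memLp v
  have hint : Integrable u volume := hmem.integrable one_le_two
  have hw : FunctionSpaces.Torus.IsSmooth w := FunctionSpaces.Torus.isSmooth_fourierTruncate m u
  -- ### pointwise bound of the integrand
  have hpt : ∀ x, ‖⟪FunctionSpaces.Torus.fderiv w x (u x), u x - w x⟫_ℝ‖ₑ ≤
      ‖FunctionSpaces.Torus.fderiv w x‖ₑ * (‖u x‖ₑ * ‖w x - u x‖ₑ) := by
    intro x
    rw [← ofReal_norm, ← ofReal_norm, ← ofReal_norm, ← ofReal_norm,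
      ← ENNReal.ofReal_mul (norm_nonneg _), ← ENNReal.ofReal_mul (norm_nonneg _)]
    refine ENNReal.ofReal_le_ofReal ?_
    calc ‖⟪FunctionSpaces.Torus.fderiv w x (u x), u x - w x⟫_ℝ‖
        ≤ ‖FunctionSpaces.Torus.fderiv w x (u x)‖ * ‖u x - w x‖ := norm_inner_le_norm _ _
      _ ≤ (‖FunctionSpaces.Torus.fderiv w x‖ * ‖u x‖) * ‖u x - w x‖ := by
          gcongr
          exact ContinuousLinearMap.le_opNorm _ _
      _ = ‖FunctionSpaces.Torus.fderiv w x‖ * (‖u x‖ * ‖w x - u x‖) := by rw [norm_sub_rev]; ring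
  -- ### measurability
  have hAm : AEMeasurable (fun x => ‖FunctionSpaces.Torus.fderiv w x‖ₑ) volume :=
    (continuous_fderiv_of_isSmooth hw).aestronglyMeasurable.aemeasurable.enorm
  have hum : AEMeasurable (fun x => ‖u x‖ₑ) volume := hmem.1.aemeasurable.enorm
  have hrm : AEMeasurable (fun x => ‖w x - u x‖ₑ) volume :=
    (hw.continuous.aestronglyMeasurable.sub hmem.1).aemeasurable.enorm
  -- ### Hölder twice
  set A : ℝ≥0∞ := ∫⁻ x, ‖FunctionSpaces.Torus.fderiv w x‖ₑ ^ 2 with hA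
  set B : ℝ≥0∞ := ∫⁻ x, ‖u x‖ₑ ^ 4 with hB
  set R : ℝ≥0∞ := ∫⁻ x, ‖w x - u x‖ₑ ^ 4 with hR
  have hH1 : ∫⁻ x, ‖FunctionSpaces.Torus.fderiv w x‖ₑ * (‖u x‖ₑ * ‖w x - u x‖ₑ) ≤
      A ^ (1 / 2 : ℝ) * (∫⁻ x, (‖u x‖ₑ * ‖w x - u x‖ₑ) ^ 2) ^ (1 / 2 : ℝ) :=
    lintegral_mul_le_sqrt volume hAm (hum.mul hrm)
  have hH2 : ∫⁻ x, (‖u x‖ₑ * ‖w x - u x‖ₑ) ^ 2 ≤ B ^ (1 / 2 : ℝ) * R ^ (1 / 2 : ℝ) := by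
    have h := lintegral_mul_le_sqrt volume (hum.pow_const 2) (hrm.pow_const 2)
    have h4 : ∀ y : ℝ≥0∞, (y ^ 2) ^ 2 = y ^ 4 := fun y => by rw [← pow_mul]
    simp only [h4] at h
    refine (le_of_eq (lintegral_congr fun x => ?_)).trans h
    ring
  -- ### `A ≤ d ‖∇u‖²`
  have hAle : A ≤ Fintype.card d * FunctionSpaces.Torus.eGradNormSq u :=
    (FunctionSpaces.Torus.lintegral_enorm_fderiv_sq_le_card_mul_eGradNormSq hw).trans
      (mul_le_mul' le_rfl (eGradNormSq_fourierTruncate_le hint m))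
  -- ### assembly
  calc ‖∫ x, ⟪FunctionSpaces.Torus.fderiv w x (u x), u x - w x⟫_ℝ‖ₑ ^ 2
      ≤ (∫⁻ x, ‖⟪FunctionSpaces.Torus.fderiv w x (u x), u x - w x⟫_ℝ‖ₑ) ^ 2 :=
        pow_le_pow_left₀ bot_le (enorm_integral_le_lintegral_enorm _) 2
    _ ≤ (∫⁻ x, ‖FunctionSpaces.Torus.fderiv w x‖ₑ * (‖u x‖ₑ * ‖w x - u x‖ₑ)) ^ 2 :=
        pow_le_pow_left₀ bot_le (lintegral_mono hpt) 2
    _ ≤ (A ^ (1 / 2 : ℝ) * (∫⁻ x, (‖u x‖ₑ * ‖w x - u x‖ₑ) ^ 2) ^ (1 / 2 : ℝ)) ^ 2 :=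
        pow_le_pow_left₀ bot_le hH1 2
    _ = A * ∫⁻ x, (‖u x‖ₑ * ‖w x - u x‖ₑ) ^ 2 := by
        rw [mul_pow, ENNReal.rpow_half_sq, ENNReal.rpow_half_sq]
    _ ≤ (Fintype.card d * FunctionSpaces.Torus.eGradNormSq u) * (B ^ (1 / 2 : ℝ) * R ^ (1 / 2 : ℝ)) :=
        mul_le_mul' hAle hH2

omit [DecidableEq d] in
/-- The `H¹` norm of a field as a spectral sum: `‖g‖²_{H¹} = ∑ₖ ⟨k⟩² ‖ĝ(k)‖²`. [folklore] -/
theorem eSobolevNorm_one_sq_eq_tsum {F : Type*} [NormedAddCommGroup F] [NormedSpace ℂ F]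
    (g : UnitAddTorus d → F) :
    FunctionSpaces.Torus.eSobolevNorm 1 g ^ 2 =
      ∑' k : d → ℤ, ENNReal.ofReal (FunctionSpaces.Torus.sobolevWeight 1 k ^ 2) * ‖mFourierCoeff g k‖ₑ ^ 2 := by
  rw [FunctionSpaces.Torus.eSobolevNorm, ENNReal.rpow_half_sq]

/-- **The truncation error in `H¹`, spectrally**: `‖P_m u − u‖²_{H¹} = ∑_{|k|>m} ⟨k⟩² ‖û(k)‖²`
(the error has the coefficients `−û(k)` off the ball and none on it). [folklore] -/
theorem eSobolevNorm_one_fourierTruncate_sub_sq {u : UnitAddTorus d → EuclideanSpace ℝ d}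
    (hu : Integrable u volume) (m : ℕ) :
    FunctionSpaces.Torus.eSobolevNorm 1
        (FunctionSpaces.EuclideanSpace.complexify ∘ (FunctionSpaces.Torus.fourierTruncate m u - u)) ^ 2 =
      ∑' k : {k : d → ℤ // k ∉ FunctionSpaces.Torus.freqBall m},
        ENNReal.ofReal (FunctionSpaces.Torus.sobolevWeight 1 (k : d → ℤ) ^ 2) *
          ‖mFourierCoeff (FunctionSpaces.EuclideanSpace.complexify ∘ u) (k : d → ℤ)‖ₑ ^ 2 := by
  rw [eSobolevNorm_one_sq_eq_tsum,
    show (∑' k : {k : d → ℤ // k ∉ FunctionSpaces.Torus.freqBall m},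
        ENNReal.ofReal (FunctionSpaces.Torus.sobolevWeight 1 (k : d → ℤ) ^ 2) *
          ‖mFourierCoeff (FunctionSpaces.EuclideanSpace.complexify ∘ u) (k : d → ℤ)‖ₑ ^ 2) =
      ∑' k : ({k : d → ℤ | k ∉ FunctionSpaces.Torus.freqBall m} : Set (d → ℤ)),
        ENNReal.ofReal (FunctionSpaces.Torus.sobolevWeight 1 (k : d → ℤ) ^ 2) *
          ‖mFourierCoeff (FunctionSpaces.EuclideanSpace.complexify ∘ u) (k : d → ℤ)‖ₑ ^ 2 from rfl,
    tsum_subtype ({k : d → ℤ | k ∉ FunctionSpaces.Torus.freqBall m} : Set (d → ℤ))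
      fun k => ENNReal.ofReal (FunctionSpaces.Torus.sobolevWeight 1 k ^ 2) *
        ‖mFourierCoeff (FunctionSpaces.EuclideanSpace.complexify ∘ u) k‖ₑ ^ 2]
  refine tsum_congr fun k => ?_
  rw [FunctionSpaces.Torus.mFourierCoeff_fourierTruncate_sub hu]
  simp only [Set.indicator_apply, Set.mem_setOf_eq]
  by_cases hk : k ∈ FunctionSpaces.Torus.freqBall m
  · simp [hk]
  · simp [hk]

/-- **The `H¹` tail of a field of finite `H¹` norm tends to zero**:
`∑_{|k|>m} ⟨k⟩² ‖û(k)‖² → 0` as `m → ∞`. [folklore] -/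
theorem tendsto_sobolev_tail {u : UnitAddTorus d → EuclideanSpace ℝ d}
    (hfin : FunctionSpaces.Torus.eSobolevNorm 1 (FunctionSpaces.EuclideanSpace.complexify ∘ u) ≠ ⊤) :
    Tendsto (fun m : ℕ => ∑' k : {k : d → ℤ // k ∉ FunctionSpaces.Torus.freqBall m},
        ENNReal.ofReal (FunctionSpaces.Torus.sobolevWeight 1 (k : d → ℤ) ^ 2) *
          ‖mFourierCoeff (FunctionSpaces.EuclideanSpace.complexify ∘ u) (k : d → ℤ)‖ₑ ^ 2)
      atTop (𝓝 0) := by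
  have hfin' : ∑' k : d → ℤ, ENNReal.ofReal (FunctionSpaces.Torus.sobolevWeight 1 k ^ 2) *
      ‖mFourierCoeff (FunctionSpaces.EuclideanSpace.complexify ∘ u) k‖ₑ ^ 2 ≠ ⊤ := by
    rw [← eSobolevNorm_one_sq_eq_tsum]
    exact ENNReal.pow_ne_top hfin
  exact (ENNReal.tendsto_tsum_compl_atTop_zero hfin').comp FunctionSpaces.Torus.tendsto_freqBall_atTop

/-- **Convergence of the inertial term in dimensions `2 ≤ d ≤ 4`**: for `v ∈ V` on `T^d`,
`∫ (v ⊗ v) : ∇P_m v → 0` as `m → ∞` (`b(v, v, P_m v) → b(v, v, v) = 0`, Temam 1979, Ch. II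
Lemma 1.3, through the continuity of `b` for `n ≤ 4`, Lemma 1.2 / (1.13): the bound
`enorm_inertialPairing_fourierTruncate_sq_le` and the Sobolev embedding `H¹(T^d) ⊂ L⁴(T^d)`,
`Torus.lintegral_enorm_pow_four_le_eSobolevNorm`, applied to `v` and to the truncation error
`P_m v − v`, whose `H¹` norm is the tail `∑_{|k|>m} ⟨k⟩² ‖v̂(k)‖² → 0`).
[cite: Temam1979, Ch. II §1.1 Lemma 1.2, (1.13); Lemma 1.3] -/
theorem tendsto_inertialPairing_fourierTruncate_of_card_le_four (hd2 : 2 ≤ Fintype.card d)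
    (hd4 : Fintype.card d ≤ 4) {v : Lp (EuclideanSpace ℝ d) 2 (volume : Measure (UnitAddTorus d))}
    (hv : v ∈ FunctionSpaces.Torus.energySpace d)
    (hV : FunctionSpaces.Torus.MemSobolev 1
      (FunctionSpaces.EuclideanSpace.complexify ∘ (v : UnitAddTorus d → EuclideanSpace ℝ d))) :
    Tendsto
      (fun m => inertialPairing v (FunctionSpaces.Torus.fourierTruncate m (v : UnitAddTorus d → EuclideanSpace ℝ d)))
      atTop (𝓝 0) := by
  obtain ⟨K, hK⟩ := FunctionSpaces.Torus.lintegral_enorm_pow_four_le_eSobolevNorm (d := d) hd2 hd4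
  set u : UnitAddTorus d → EuclideanSpace ℝ d := (v : UnitAddTorus d → EuclideanSpace ℝ d) with hu
  have hmem : MemLp u 2 volume := Lp.memLp v
  have hint : Integrable u volume := hmem.integrable one_le_two
  set H : ℝ≥0∞ := FunctionSpaces.Torus.eSobolevNorm 1 (FunctionSpaces.EuclideanSpace.complexify ∘ u) with hH
  have hHfin : H ≠ ⊤ := hV.2.ne
  set G : ℝ≥0∞ := FunctionSpaces.Torus.eGradNormSq u with hG
  have hGfin : G ≠ ⊤ := hV.eGradNormSq_lt_top.ne
  set B : ℝ≥0∞ := ∫⁻ x, ‖u x‖ₑ ^ 4 with hB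
  have hBfin : B ≠ ⊤ :=
    ne_top_of_le_ne_top (ENNReal.mul_ne_top ENNReal.coe_ne_top (ENNReal.pow_ne_top hHfin)) (hK u hmem)
  -- the `H¹` tail
  set T : ℕ → ℝ≥0∞ := fun m => ∑' k : {k : d → ℤ // k ∉ FunctionSpaces.Torus.freqBall m},
    ENNReal.ofReal (FunctionSpaces.Torus.sobolevWeight 1 (k : d → ℤ) ^ 2) *
      ‖mFourierCoeff (FunctionSpaces.EuclideanSpace.complexify ∘ u) (k : d → ℤ)‖ₑ ^ 2 with hT
  have hT0 : Tendsto T atTop (𝓝 0) := tendsto_sobolev_tail hHfin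
  have hTle : ∀ m, T m ≤ H ^ 2 := fun m => by
    rw [hH, eSobolevNorm_one_sq_eq_tsum]
    exact ENNReal.tsum_comp_le_tsum_of_injective Subtype.val_injective _
  have hTfin : ∀ m, T m ≠ ⊤ := fun m => ne_top_of_le_ne_top (ENNReal.pow_ne_top hHfin) (hTle m)
  -- the truncation error in `L⁴`: `∫ ‖P_m u - u‖⁴ ≤ K T_m²`
  have hR : ∀ m, ∫⁻ x, ‖FunctionSpaces.Torus.fourierTruncate m u x - u x‖ₑ ^ 4 ≤ K * T m ^ 2 := by
    intro m
    have h := hK (FunctionSpaces.Torus.fourierTruncate m u - u)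
      ((FunctionSpaces.Torus.memLp_fourierTruncate m u 2).sub hmem)
    rw [show FunctionSpaces.Torus.eSobolevNorm 1 (FunctionSpaces.EuclideanSpace.complexify ∘
        (FunctionSpaces.Torus.fourierTruncate m u - u)) ^ 4 =
        (FunctionSpaces.Torus.eSobolevNorm 1 (FunctionSpaces.EuclideanSpace.complexify ∘
          (FunctionSpaces.Torus.fourierTruncate m u - u)) ^ 2) ^ 2 by rw [← pow_mul],
      eSobolevNorm_one_fourierTruncate_sub_sq hint m] at h
    exact h
  -- the bound `‖∫ (u ⊗ u) : ∇P_m u‖² ≤ C T_m`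
  set C : ℝ≥0∞ := (Fintype.card d * G) * (B ^ (1 / 2 : ℝ) * (K : ℝ≥0∞) ^ (1 / 2 : ℝ)) with hC
  have hCfin : C ≠ ⊤ := by
    refine ENNReal.mul_ne_top (ENNReal.mul_ne_top (ENNReal.natCast_ne_top _) hGfin)
      (ENNReal.mul_ne_top ?_ ?_)
    · exact ENNReal.rpow_ne_top_of_nonneg (by norm_num) hBfin
    · exact ENNReal.rpow_ne_top_of_nonneg (by norm_num) ENNReal.coe_ne_top
  have hbound : ∀ m,
      ‖inertialPairing v (FunctionSpaces.Torus.fourierTruncate m u)‖ₑ ^ 2 ≤ C * T m := by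
    intro m
    have hsq : (K * T m ^ 2 : ℝ≥0∞) ^ (1 / 2 : ℝ) = (K : ℝ≥0∞) ^ (1 / 2 : ℝ) * T m := by
      rw [ENNReal.mul_rpow_of_nonneg _ _ (by norm_num), ← ENNReal.rpow_natCast, ← ENNReal.rpow_mul]
      norm_num
    calc ‖inertialPairing v (FunctionSpaces.Torus.fourierTruncate m u)‖ₑ ^ 2
        ≤ (Fintype.card d * G) * (B ^ (1 / 2 : ℝ) *
            (∫⁻ x, ‖FunctionSpaces.Torus.fourierTruncate m u x - u x‖ₑ ^ 4) ^ (1 / 2 : ℝ)) :=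
          enorm_inertialPairing_fourierTruncate_sq_le hv m
      _ ≤ (Fintype.card d * G) * (B ^ (1 / 2 : ℝ) * (K * T m ^ 2) ^ (1 / 2 : ℝ)) := by
          gcongr
          exact hR m
      _ = C * T m := by rw [hsq, hC]; ring
  -- pass to real numbers and conclude
  have hreal : ∀ m, (inertialPairing v (FunctionSpaces.Torus.fourierTruncate m u)) ^ 2 ≤
      C.toReal * (T m).toReal := by
    intro m
    have h := hbound m
    rw [Real.enorm_eq_ofReal_abs, ← ENNReal.ofReal_pow (abs_nonneg _), sq_abs] at h
    rw [← ENNReal.toReal_mul]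
    exact (ENNReal.ofReal_le_iff_le_toReal (ENNReal.mul_ne_top hCfin (hTfin m))).1 h
  have hTreal : Tendsto (fun m => (T m).toReal) atTop (𝓝 0) := by
    rw [← ENNReal.toReal_zero]
    exact (ENNReal.tendsto_toReal ENNReal.zero_ne_top).comp hT0
  have hlim : Tendsto (fun m => Real.sqrt (C.toReal * (T m).toReal)) atTop (𝓝 0) := by
    have := (hTreal.const_mul C.toReal).sqrt
    rw [mul_zero, Real.sqrt_zero] at this
    exact this
  refine squeeze_zero_norm (fun m => ?_) hlim
  rw [Real.norm_eq_abs, ← Real.sqrt_sq_eq_abs]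
  exact Real.sqrt_le_sqrt (hreal m)

end Inertial

/-! ### Dimensions `d ≤ 1`: `H = {0}` -/

section Degenerate

/-- On a torus of dimension at most one, every field in `H` has vanishing Fourier coefficients
(`û(0) = 0` by the mean-zero condition; for `k ≠ 0` the index type is a singleton `{j}`,
`k_j ≠ 0`, and transversality `k · û(k) = k_j û(k)_j = 0` forces `û(k) = 0`), so `H = {0}`.
[folklore] -/
theorem mFourierCoeff_coe_eq_zero_of_card_le_one (hd : Fintype.card d ≤ 1)
    {v : Lp (EuclideanSpace ℝ d) 2 (volume : Measure (UnitAddTorus d))}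
    (hv : v ∈ FunctionSpaces.Torus.energySpace d) (k : d → ℤ) :
    mFourierCoeff (FunctionSpaces.EuclideanSpace.complexify ∘ (v : UnitAddTorus d → EuclideanSpace ℝ d)) k = 0 := by
  by_cases hk : k = 0
  · subst hk
    exact mFourierCoeff_complexify_coe_zero_of_mem hv
  · obtain ⟨j, hj⟩ : ∃ j, k j ≠ 0 := Function.ne_iff.1 hk
    -- the index type is the singleton `{j}`
    have hsub : ∀ i : d, i = j := fun i => by
      by_contra hij
      have h2 : 2 ≤ Fintype.card d := by
        have h := Finset.card_le_univ ({i, j} : Finset d)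
        rw [Finset.card_pair hij] at h
        exact h
      omega
    have htr := (isWeaklyDivFree_of_mem_energySpace hv).sum_mul_mFourierCoeff_eq_zero (Lp.memLp v) k
    rw [Fintype.sum_eq_single j fun i hi => absurd (hsub i) hi] at htr
    have hkj : (k j : ℂ) ≠ 0 := by exact_mod_cast hj
    have hcj := (mul_eq_zero.1 htr).resolve_left hkj
    ext i
    rw [hsub i, hcj]
    rfl

/-- On a torus of dimension at most one the truncations of a field in `H` vanish. [folklore] -/
theorem fourierTruncate_coe_eq_zero_of_card_le_one (hd : Fintype.card d ≤ 1)
    {v : Lp (EuclideanSpace ℝ d) 2 (volume : Measure (UnitAddTorus d))}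
    (hv : v ∈ FunctionSpaces.Torus.energySpace d) (m : ℕ) :
    FunctionSpaces.Torus.fourierTruncate m (v : UnitAddTorus d → EuclideanSpace ℝ d) = 0 := by
  rw [FunctionSpaces.Torus.fourierTruncate_eq,
    FunctionSpaces.Torus.realTrigPoly_congr (c' := 0) fun k _ => mFourierCoeff_coe_eq_zero_of_card_le_one hd hv k,
    FunctionSpaces.Torus.realTrigPoly_zero]

omit [DecidableEq d] in
/-- The inertial pairing against the zero field vanishes. [folklore] -/
theorem inertialPairing_zero (w : Lp (EuclideanSpace ℝ d) 2 (volume : Measure (UnitAddTorus d))) :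
    inertialPairing w (0 : UnitAddTorus d → EuclideanSpace ℝ d) = 0 := by
  have h : ∀ x : UnitAddTorus d, FunctionSpaces.Torus.fderiv (0 : UnitAddTorus d → EuclideanSpace ℝ d) x = 0 := by
    intro x
    have hl : FunctionSpaces.Torus.liftAt (0 : UnitAddTorus d → EuclideanSpace ℝ d) x =
        fun _ => (0 : EuclideanSpace ℝ d) := rfl
    rw [FunctionSpaces.Torus.fderiv, hl]
    exact fderiv_const_apply 0
  simp [inertialPairing, h]

end Degenerate

/-! ### The energy equation and the Dirac stationary statistical solutions -/

section EnergyEquation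

/-- **Energy equation of steady weak solutions on `T^d`, `d ≤ 4`** (Temam 1979, Ch. II §1,
(1.21)–(1.22) in the proof of Thm. 1.2; FMRT 2001, Ch. IV (1.8); Constantin–Foias 1988, Ch. 7
(7.2), (7.8)), every universe: if `f ∈ L²`, `u ∈ V` and
`(f, w) + ν (u, Δw) + ∫ (u ⊗ u) : ∇w = 0` for all `w ∈ 𝒱`, then `ν ‖∇u‖²_{L²} = (u, f)`.
Proof: test with `w = P_m u` (`galerkin_identity`) and let `m → ∞`
(`tendsto_integral_inner_fourierTruncate`, `tendsto_toReal_eGradNormSq_fourierTruncate`, and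
`tendsto_inertialPairing_fourierTruncate_of_card_le_four` for `2 ≤ d ≤ 4`, resp. the vanishing
of all truncations for `d ≤ 1`). [cite: Temam1979, Ch. II Thm. 1.2, (1.21)–(1.22)] -/
theorem IsSteadyWeakSolution.energy_eq' (hd : Fintype.card d ≤ 4) {ν : ℝ}
    {f : UnitAddTorus d → EuclideanSpace ℝ d} (hf : MemLp f 2 volume)
    {u : FunctionSpaces.Torus.energySpace d}
    (hV : (u : Lp (EuclideanSpace ℝ d) 2 (volume : Measure (UnitAddTorus d))) ∈
      FunctionSpaces.Torus.energySpaceV d)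
    (hu : IsSteadyWeakSolution ν f u) :
    ν * (FunctionSpaces.Torus.eGradNormSq
        ((u : Lp (EuclideanSpace ℝ d) 2 (volume : Measure (UnitAddTorus d))) :
          UnitAddTorus d → EuclideanSpace ℝ d)).toReal =
      pairing (u : Lp (EuclideanSpace ℝ d) 2 (volume : Measure (UnitAddTorus d))) f := by
  set v : Lp (EuclideanSpace ℝ d) 2 (volume : Measure (UnitAddTorus d)) :=
    (u : Lp (EuclideanSpace ℝ d) 2 (volume : Measure (UnitAddTorus d))) with hv_def
  set U : UnitAddTorus d → EuclideanSpace ℝ d := (v : UnitAddTorus d → EuclideanSpace ℝ d) with hU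
  have hvH : v ∈ FunctionSpaces.Torus.energySpace d := u.2
  have hmem : MemLp U 2 volume := Lp.memLp v
  have hint : Integrable U volume := hmem.integrable one_le_two
  have hfin : FunctionSpaces.Torus.eGradNormSq U ≠ ⊤ := hV.2.eGradNormSq_lt_top.ne
  -- the three limits
  have h1 : Tendsto (fun m => ∫ x, ⟪f x, FunctionSpaces.Torus.fourierTruncate m U x⟫_ℝ) atTop
      (𝓝 (∫ x, ⟪f x, U x⟫_ℝ)) := tendsto_integral_inner_fourierTruncate hf hmem
  have h2 : Tendsto (fun m => (FunctionSpaces.Torus.eGradNormSq (FunctionSpaces.Torus.fourierTruncate m U)).toReal)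
      atTop (𝓝 (FunctionSpaces.Torus.eGradNormSq U).toReal) :=
    tendsto_toReal_eGradNormSq_fourierTruncate hint hfin
  have h3 : Tendsto (fun m => inertialPairing v (FunctionSpaces.Torus.fourierTruncate m U)) atTop (𝓝 0) := by
    by_cases hd2 : 2 ≤ Fintype.card d
    · exact tendsto_inertialPairing_fourierTruncate_of_card_le_four hd2 hd hvH hV.2
    · have h0 : ∀ m, inertialPairing v (FunctionSpaces.Torus.fourierTruncate m U) = 0 := fun m => by
        rw [hU, fourierTruncate_coe_eq_zero_of_card_le_one (by omega) hvH m, inertialPairing_zero]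
      simp only [h0]
      exact tendsto_const_nhds
  -- the Galerkin identities pass to the limit
  have hlim : Tendsto (fun m => (∫ x, ⟪f x, FunctionSpaces.Torus.fourierTruncate m U x⟫_ℝ) -
      ν * (FunctionSpaces.Torus.eGradNormSq (FunctionSpaces.Torus.fourierTruncate m U)).toReal +
      inertialPairing v (FunctionSpaces.Torus.fourierTruncate m U)) atTop
      (𝓝 ((∫ x, ⟪f x, U x⟫_ℝ) - ν * (FunctionSpaces.Torus.eGradNormSq U).toReal + 0)) :=
    (h1.sub (h2.const_mul ν)).add h3
  have hgal : ∀ m, (∫ x, ⟪f x, FunctionSpaces.Torus.fourierTruncate m U x⟫_ℝ) -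
      ν * (FunctionSpaces.Torus.eGradNormSq (FunctionSpaces.Torus.fourierTruncate m U)).toReal +
      inertialPairing v (FunctionSpaces.Torus.fourierTruncate m U) = 0 := fun m => hu.galerkin_identity m
  have hzero : Tendsto (fun m => (∫ x, ⟪f x, FunctionSpaces.Torus.fourierTruncate m U x⟫_ℝ) -
      ν * (FunctionSpaces.Torus.eGradNormSq (FunctionSpaces.Torus.fourierTruncate m U)).toReal +
      inertialPairing v (FunctionSpaces.Torus.fourierTruncate m U)) atTop (𝓝 0) := by
    rw [show (fun m => (∫ x, ⟪f x, FunctionSpaces.Torus.fourierTruncate m U x⟫_ℝ) -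
      ν * (FunctionSpaces.Torus.eGradNormSq (FunctionSpaces.Torus.fourierTruncate m U)).toReal +
      inertialPairing v (FunctionSpaces.Torus.fourierTruncate m U)) = fun _ => (0 : ℝ) from funext hgal]
    exact tendsto_const_nhds
  have heq := tendsto_nhds_unique hlim hzero
  rw [add_zero, sub_eq_zero] at heq
  -- `(f, u) = (u, f)`
  have hsymm : (∫ x, ⟪f x, U x⟫_ℝ) = pairing v f := by
    rw [pairing]
    exact integral_congr_ae (ae_of_all _ fun x => real_inner_comm _ _)
  rw [← hsymm, heq]

/-- **Discharge of the named fact `Temam1979_steadyWeakSolution_energy_eq`** (Temam 1979,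
Ch. II §1, Thm. 1.2 with (1.21)–(1.22): the energy equation `ν ‖∇u‖² = (f, u)` of steady weak
solutions `u ∈ V`, `d ≤ 4`). [cite: Temam1979, Ch. II Thm. 1.2, (1.21)–(1.22)] -/
theorem Temam1979_steadyWeakSolution_energy_eq_holds : Temam1979_steadyWeakSolution_energy_eq :=
  fun hd _ _ hf _ hV hu => IsSteadyWeakSolution.energy_eq' hd hf hV hu

/-- **Discharge of the named fact `isStationaryStatisticalSolution_dirac`** (Foias–Manley–Rosa–
Temam 2001, Ch. IV §1.2, remark pp. 181–182: the Dirac measure `δ_u` at a stationary solution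
`u ∈ V` is a stationary statistical solution, Def. 1.3 (1.29)–(1.31)); here for steady weak
solutions on `T^d` with `0 ≤ ν`, `f ∈ L²`, `d ≤ 4`: the reduction
`IsSteadyWeakSolution.isStationaryStatisticalSolution_dirac` fed with the energy equation
`IsSteadyWeakSolution.energy_eq'`. [cite: FMRT2001, Ch. IV §1.2, remark pp. 181–182] -/
theorem isStationaryStatisticalSolution_dirac_holds : isStationaryStatisticalSolution_dirac (d := d) :=
  fun _ _ hf hd _ hV hu =>
    hu.isStationaryStatisticalSolution_dirac hV (IsSteadyWeakSolution.energy_eq' hd hf hV hu).le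

end EnergyEquation

end Torus

end Literature.Analysis.FluidPDE
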